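import Summits.ABC.IUTFork.Joshi.PrototypeJointModelInduced
import Mathlib.Data.Int.Log
import HarnessLib

/-!
# W6, part 1 — the Teichmüller VALUE maps of a print-shaped [J-IIp] §10.13 model: orbit normalisation on `Y = Q̄_p/∼` and the
# input `ClassLift` (one norm-preserving surjection on the `μ_{p^∞}`-classes); `Φ`-compatibility `L_{ϕw}(c^p) = L_w(c)` in kernel

Test-side support file of the abc-iut cell, block E «type Joshi's construction, test vs S» (rung LADDER-ABC:A2.E; seat abc-iut-E-t50
gen 5 — item W6 of abc-iut-E-cx-2's VACUITY column, OPENED by this seat's boundary theorem p447117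
`PeriodRingDatum.not_teichFrob_of_transport_everywhere` («transport at EVERY `y : Y`» ∧ Witt law is unsatisfiable over the signature)
and CLAIMED 2026-08-26T13:31:38Z in concert with abc-iut-E-t52 g4 (who supplies a `ClassLift` inhabitant by cardinality and holds the
`B^{φ=p} ≠ 0` upgrade on the shifted ring p445632). Part 2 = `Joshi/PrototypeWittModel.lean` (the datum and the W6 theorems).
Carriers and tools BY NAME, nothing restated: E-t57's `JointModel.Pt` / `mk` / `e` / `frobPt` / `Adm` / `norm_rpow_inv_sc` (p441701),
E-t7 g5's `JointModel.Induced.frobEquiv` / `e_frobPt` (p446419), E-t3's `ExpModel.lift` / `sc` / `expQ` (p434861). TAKES NO SIDE on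
[IUTchIII] Cor. 3.12, on Joshi's claims, or on Mochizuki's reports on them; no FACT-LIST row; nothing about print is asserted — this file
is model-building bookkeeping over `Q̄_p = PadicAlgCl p`. [folklore]

WHAT IS HERE.
* §1 `ClassLift p` — the ONE external input of the W6 model (HYPOTHESIS structure, data): a map `Λ : Q̄_p/∼ → Q̄_p` with `‖Λ w‖ = ‖w.out‖`
  and `Λ` onto. (E-t52 g4's necessity remark, HOME/STATUS 13:23:56Z: under §10.13 transports along an orbit, `η_y ∘ [·]` must be
  `μ_{p^∞}`-invariant — so SOME such class-level datum is forced; inhabitants: cardinality (E-t52), or the Iwasawa logarithm of `ℚ̄_p`.)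
* §2 Orbit bookkeeping for `σ := ϕ` as a permutation of `Y`: `ν(σ^k w) = ν(w)^{p^k}` (`ν` = the common norm of a class), the orbit index
  `n(w) := ⌊log_p e(w)⌋` (Mathlib `Int.log`; `n(σ w) = n(w) + 1`) and the base exponent `r(w) := e(w)/p^{n(w)}` (`r(σ w) = r(w)`), for
  classical classes (`e(w) > 0`, i.e. `w = [a]` with `0 < ‖a‖ < 1`).
* §3 **The value map** `L_w : Q̄_p → Q̄_p`: at a classical `w`, `L_w(c) := τ_w (lift_{r(w)} (Λ (σ^{−n(w)} [c])))` — through the CLASS of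
  `c`, shifted to the base of the `ϕ`-orbit of `w`, read by `Λ`, rescaled by E-t3's `lift`, and finally `τ_w` = the transposition swapping the
  diagonal value `L_w([w])` with `p` (so that `EtaPtTeich` holds on the nose); at junk classes `L_w := lift_{e(w)}`. PROVED: (A1)
  `‖L_w(c)‖^{sc e(w)} = ‖c‖` (`norm_value_rpow`), (A2) `L_w` onto (`value_surjective`), the diagonal `L_w(c) = p` for `[c] = w` (`value_diag`), and the
  **`Φ`-compatibility `L_{σ w}(c^p) = L_w(c)`** (`value_frobPerm`) — pure group arithmetic `σ^{−(n+1)} ∘ σ = σ^{−n}` in `Perm Y`; this identity is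
  what makes `η_{ϕ(w)} ∘ φ = η_w`, i.e. §10.13's transport, hold in part 2 at every classical class.
-/

noncomputable section

open Function Set
open scoped Classical

namespace Summit.ABC.IUTFork.Joshi.JointModel.Witt

variable (p : ℕ) [hp : Fact p.Prime]

/-! ## 1. The INPUT: one norm-preserving surjection on the classes `Y = Q̄_p/∼` (hypothesis structure, DATA; supplied elsewhere) -/

/-- **`ClassLift p`** — a map `Λ : Q̄_p/∼ → Q̄_p` (`a ∼ b :⇔ ∃ n, a^{pⁿ} = b^{pⁿ}`, p441701's `JointModel.Pt`) that PRESERVES NORMS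
(`‖Λ w‖ = ‖w.out‖`, the common norm of the class) and is ONTO `Q̄_p`. Equivalently (E-t52 g4's form): a `μ_{p^∞}`-invariant,
norm-preserving surjection `Q̄_p → Q̄_p`, composed with `Quotient.out`. HYPOTHESIS structure (data), nothing asserted here; inhabitants
are supplied separately (cardinality, or the Iwasawa logarithm of `ℚ̄_p`). [folklore] -/
structure ClassLift where
  /-- the class map `Λ` -/
  toFun : Pt p → PadicAlgCl p
  /-- `‖Λ w‖ = ‖w.out‖` -/
  norm_apply : ∀ w : Pt p, ‖toFun w‖ = ‖w.out‖
  /-- `Λ` is onto `Q̄_p` -/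
  surjective : Surjective toFun

variable {p} (Λ : ClassLift p)

/-! ## 2. Orbit bookkeeping on `Y`: the point-Frobenius `σ = ϕ` as a permutation, exponents `e(σ^k w) = p^k e(w)`, the orbit index
`n(w) := ⌊log_p e(w)⌋`, the base exponent `r(w) := e(w)/p^{n(w)}`, norms of classes along orbits -/

variable (p) in
/-- p446419's `frobEquiv` (`ϕ([a]) = [a^p]` as a permutation of `Y`). [folklore] -/
abbrev frobPerm : Equiv.Perm (Pt p) := Induced.frobEquiv p

variable (p) in
/-- `e(σ⁻¹ w) = e(w)/p`. [folklore] -/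
theorem e_symm (w : Pt p) : e p ((frobPerm p).symm w) = e p w / p := by
  have h := Induced.e_frobPt p ((frobPerm p).symm w)
  rw [show frobPt p ((frobPerm p).symm w) = w from (Induced.frobEquiv p).apply_symm_apply w] at h
  have hp0 : (p : ℚ) ≠ 0 := Nat.cast_ne_zero.2 hp.out.ne_zero
  rw [h, mul_div_cancel_left₀ _ hp0]

variable (p) in
/-- The common norm of a class: `ν(w) := ‖w.out‖` (`= ‖c‖` for every `c` with `[c] = w`, p441701 `norm_eq_of_rel`). [folklore] -/
def classNorm (w : Pt p) : ℝ := ‖w.out‖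

variable (p) in
/-- `ν(w) ≥ 0`. [folklore] -/
theorem classNorm_nonneg (w : Pt p) : 0 ≤ classNorm p w := norm_nonneg _

variable (p) in
/-- `ν([c]) = ‖c‖`. [folklore] -/
theorem classNorm_mk (c : PadicAlgCl p) : classNorm p (mk p c) = ‖c‖ := norm_eq_of_rel p (rel_out_mk p c)

variable (p) in
/-- `ν(σ w) = ν(w)^p`. [folklore] -/
theorem classNorm_frobPerm (w : Pt p) : classNorm p (frobPerm p w) = classNorm p w ^ (p : ℝ) := by
  induction w using Quotient.inductionOn with | h c => ?_
  change classNorm p (frobPt p (mk p c)) = classNorm p (mk p c) ^ (p : ℝ)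
  rw [frobPt_mk, classNorm_mk, classNorm_mk, norm_pow, Real.rpow_natCast]

variable (p) in
/-- `ν(σ⁻¹ w) = ν(w)^{1/p}`. [folklore] -/
theorem classNorm_symm (w : Pt p) : classNorm p ((frobPerm p).symm w) = classNorm p w ^ ((p : ℝ)⁻¹) := by
  have h := classNorm_frobPerm p ((frobPerm p).symm w)
  rw [Equiv.apply_symm_apply] at h
  rw [h, ← Real.rpow_mul (classNorm_nonneg p _), mul_inv_cancel₀ (Nat.cast_ne_zero.2 hp.out.ne_zero), Real.rpow_one]

variable (p) in
/-- **`ν(σ^k w) = ν(w)^{p^k}`** for every `k ∈ ℤ`. [folklore] -/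
theorem classNorm_zpow (k : ℤ) (w : Pt p) : classNorm p ((frobPerm p ^ k) w) = classNorm p w ^ ((p : ℝ) ^ k) := by
  have hp0 : (p : ℝ) ≠ 0 := Nat.cast_ne_zero.2 hp.out.ne_zero
  induction k using Int.induction_on generalizing w with
  | zero => simp
  | succ k ih =>
    rw [zpow_add_one, Equiv.Perm.mul_apply, ih, classNorm_frobPerm, ← Real.rpow_mul (classNorm_nonneg p _), zpow_add_one₀ hp0]
    congr 1; ring
  | pred k ih =>
    rw [zpow_sub_one, Equiv.Perm.mul_apply, ih, show (frobPerm p)⁻¹ w = (frobPerm p).symm w from rfl, classNorm_symm,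
      ← Real.rpow_mul (classNorm_nonneg p _), zpow_sub_one₀ hp0]
    congr 1; ring

variable (p) in
/-- The orbit index of a classical class: `n(w) := ⌊log_p e(w)⌋` (Mathlib `Int.log`). [folklore] -/
def orbitIdx (w : Pt p) : ℤ := Int.log p (e p w)

variable (p) in
/-- `⌊log_p (p·r)⌋ = ⌊log_p r⌋ + 1` for `r > 0` (Mathlib's `Int.log`, characterised by `Int.zpow_le_iff_le_log`). [folklore] -/
theorem int_log_mul_base {r : ℚ} (hr : 0 < r) : Int.log p ((p : ℚ) * r) = Int.log p r + 1 := by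
  have hb : 1 < p := hp.out.one_lt
  have hp0 : (0 : ℚ) < p := Nat.cast_pos.2 hp.out.pos
  have hpr : 0 < (p : ℚ) * r := mul_pos hp0 hr
  apply le_antisymm
  · have h1 : (p : ℚ) ^ (Int.log p ((p : ℚ) * r) - 1) ≤ r := by
      have h0 := Int.zpow_log_le_self hb hpr
      rw [zpow_sub_one₀ hp0.ne']
      calc (p : ℚ) ^ Int.log p ((p : ℚ) * r) * (p : ℚ)⁻¹ ≤ (p : ℚ) * r * (p : ℚ)⁻¹ := by gcongr
        _ = r := by field_simp
    have h2 := (Int.zpow_le_iff_le_log hb hr).1 h1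
    linarith
  · have h1 : (p : ℚ) ^ (Int.log p r + 1) ≤ (p : ℚ) * r := by
      rw [zpow_add_one₀ hp0.ne', mul_comm ((p : ℚ) ^ _)]
      gcongr
      exact Int.zpow_log_le_self hb hr
    exact (Int.zpow_le_iff_le_log hb hpr).1 h1

variable (p) in
/-- `n(σ w) = n(w) + 1` when `e(w) > 0`. [folklore] -/
theorem orbitIdx_frobPerm {w : Pt p} (hw : 0 < e p w) : orbitIdx p (frobPerm p w) = orbitIdx p w + 1 := by
  unfold orbitIdx
  rw [show (frobPerm p) w = frobPt p w from rfl, Induced.e_frobPt, int_log_mul_base p hw]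

variable (p) in
/-- The base exponent of an orbit, read at `w`: `r(w) := e(w) / p^{n(w)}`. [folklore] -/
def baseExp (w : Pt p) : ℚ := e p w / (p : ℚ) ^ orbitIdx p w

variable (p) in
/-- `r(σ w) = r(w)` when `e(w) > 0`: the base exponent is an orbit invariant. [folklore] -/
theorem baseExp_frobPerm {w : Pt p} (hw : 0 < e p w) : baseExp p (frobPerm p w) = baseExp p w := by
  unfold baseExp
  rw [orbitIdx_frobPerm p hw, show (frobPerm p) w = frobPt p w from rfl, Induced.e_frobPt, zpow_add_one₀ (Nat.cast_ne_zero.2 hp.out.ne_zero)]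
  have hp0 : (p : ℚ) ≠ 0 := Nat.cast_ne_zero.2 hp.out.ne_zero
  have hpn : (p : ℚ) ^ orbitIdx p w ≠ 0 := zpow_ne_zero _ hp0
  field_simp

variable (p) in
/-- `r(w) > 0` when `e(w) > 0`. [folklore] -/
theorem baseExp_pos {w : Pt p} (hw : 0 < e p w) : 0 < baseExp p w :=
  div_pos hw (zpow_pos (Nat.cast_pos.2 hp.out.pos) _)

variable (p) in
/-- `p^{n(w)} · r(w) = e(w)`. [folklore] -/
theorem zpow_mul_baseExp (w : Pt p) : (p : ℚ) ^ orbitIdx p w * baseExp p w = e p w := by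
  unfold baseExp
  rw [mul_div_cancel₀ _ (zpow_ne_zero _ (Nat.cast_ne_zero.2 hp.out.ne_zero))]

/-- A class `w` with `e(w) > 0` has ADMISSIBLE representatives (`0 < ‖w.out‖ < 1`): `expQ` is positive only there. [folklore] -/
theorem adm_out_of_e_pos {w : Pt p} (hw : 0 < e p w) : Adm p w.out := by
  unfold e ExpModel.expQ at hw
  split_ifs at hw with h
  · exact h
  · exact absurd hw (lt_irrefl 0)

/-- For `e(w) > 0`: `sc e(w) = e(w)` and `ν(w)^{1/e(w)} = ‖p‖`. [folklore] -/
theorem classNorm_rpow_inv_e {w : Pt p} (hw : 0 < e p w) : classNorm p w ^ ((1 : ℝ) / (e p w : ℝ)) = ‖(p : PadicAlgCl p)‖ := by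
  have h := norm_rpow_inv_sc p (adm_out_of_e_pos hw)
  rw [ExpModel.sc_of_pos (by rw [← e] ; exact hw)] at h
  exact h

/-! ## 3. The Teichmüller VALUE map `L_w : Q̄_p → Q̄_p` at a class `w`: through the class of the argument, normalised to the base of the
`ϕ`-orbit of `w`, read by `Λ`, rescaled by E-t3's `lift`, and with the diagonal value swapped to `p` (for `EtaPtTeich`) -/

/-- The raw value at a classical `w` of a class `u`: `V_w(u) := lift_{r(w)} (Λ (σ^{−n(w)} u))`. [folklore] -/
def rawValue (w u : Pt p) : PadicAlgCl p := ExpModel.lift p (baseExp p w) (Λ.toFun ((frobPerm p ^ (-(orbitIdx p w))) u))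

/-- `‖V_w(u)‖ = ν(u)^{1/e(w)}` for `e(w) > 0`. [folklore] -/
theorem norm_rawValue {w : Pt p} (hw : 0 < e p w) (u : Pt p) : ‖rawValue Λ w u‖ = classNorm p u ^ ((1 : ℝ) / (e p w : ℝ)) := by
  unfold rawValue
  rw [ExpModel.norm_lift, Λ.norm_apply, ← classNorm, classNorm_zpow, ← Real.rpow_mul (classNorm_nonneg p u), ExpModel.sc_of_pos (baseExp_pos p hw)]
  congr 1
  have he : ((e p w : ℚ) : ℝ) = (((p : ℚ) ^ orbitIdx p w * baseExp p w : ℚ) : ℝ) := by rw [zpow_mul_baseExp]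
  rw [he]
  push_cast
  have hp0 : (p : ℝ) ≠ 0 := Nat.cast_ne_zero.2 hp.out.ne_zero
  have hr0 : ((baseExp p w : ℚ) : ℝ) ≠ 0 := by exact_mod_cast (baseExp_pos p hw).ne'
  rw [zpow_neg]
  field_simp

/-- `V_{σ w}(σ u) = V_w(u)`: orbit normalisation makes the raw value `Φ`-INVARIANT (`Φ = (σ, σ)`), by group arithmetic in `Perm Y`. [folklore] -/
theorem rawValue_frobPerm {w : Pt p} (hw : 0 < e p w) (u : Pt p) : rawValue Λ (frobPerm p w) (frobPerm p u) = rawValue Λ w u := by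
  unfold rawValue
  rw [baseExp_frobPerm p hw, orbitIdx_frobPerm p hw]
  congr 2
  rw [show (frobPerm p) u = (frobPerm p ^ (1 : ℤ)) u by rw [zpow_one], ← Equiv.Perm.mul_apply, ← zpow_add]
  congr 2
  ring

/-- The diagonal raw value `m₀(w) := V_w(w)`; it has norm `‖p‖`. [folklore] -/
def diagValue (w : Pt p) : PadicAlgCl p := rawValue Λ w w

/-- `‖m₀(w)‖ = ‖p‖` for `e(w) > 0`. [folklore] -/
theorem norm_diagValue {w : Pt p} (hw : 0 < e p w) : ‖diagValue Λ w‖ = ‖(p : PadicAlgCl p)‖ := by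
  unfold diagValue; rw [norm_rawValue Λ hw, classNorm_rpow_inv_e hw]

/-- `m₀(σ w) = m₀(w)`. [folklore] -/
theorem diagValue_frobPerm {w : Pt p} (hw : 0 < e p w) : diagValue Λ (frobPerm p w) = diagValue Λ w := rawValue_frobPerm Λ hw w

/-- The diagonal swap `τ_w := (m₀(w) p)` — a norm-preserving bijection of `Q̄_p` moving the diagonal raw value to `p`. [folklore] -/
def diagSwap (w : Pt p) : Equiv.Perm (PadicAlgCl p) := Equiv.swap (diagValue Λ w) (p : PadicAlgCl p)

/-- `τ_w` preserves norms (it swaps two elements of norm `‖p‖`). [folklore] -/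
theorem norm_diagSwap {w : Pt p} (hw : 0 < e p w) (x : PadicAlgCl p) : ‖diagSwap Λ w x‖ = ‖x‖ := by
  unfold diagSwap
  rw [Equiv.swap_apply_def]
  split_ifs with h1 h2
  · rw [h1, norm_diagValue Λ hw]
  · rw [h2, norm_diagValue Λ hw]
  · rfl

/-- **The Teichmüller value map at `w`**: `L_w(c) := τ_w (V_w [c])` at classical `w` (`e(w) > 0`), E-t3's `lift_{e(w)}` at junk
classes. [folklore] -/
def value (w : Pt p) (c : PadicAlgCl p) : PadicAlgCl p :=
  if 0 < e p w then diagSwap Λ w (rawValue Λ w (mk p c)) else ExpModel.lift p (e p w) c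

/-- **(A1)**: `‖L_w(c)‖^{sc e(w)} = ‖c‖`. [folklore] -/
theorem norm_value_rpow (w : Pt p) (c : PadicAlgCl p) : ‖value Λ w c‖ ^ ExpModel.sc (e p w) = ‖c‖ := by
  unfold value
  split_ifs with hw
  · rw [norm_diagSwap Λ hw, norm_rawValue Λ hw, classNorm_mk, ← Real.rpow_mul (norm_nonneg c), ExpModel.sc_of_pos hw,
      one_div_mul_cancel (by exact_mod_cast hw.ne'), Real.rpow_one]
  · exact ExpModel.norm_lift_rpow p _ c

/-- At classical `w`: `‖L_w(c)‖ = ‖c‖^{1/e(w)}`. [folklore] -/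
theorem norm_value {w : Pt p} (hw : 0 < e p w) (c : PadicAlgCl p) : ‖value Λ w c‖ = ‖c‖ ^ ((1 : ℝ) / (e p w : ℝ)) := by
  unfold value; rw [if_pos hw, norm_diagSwap Λ hw, norm_rawValue Λ hw, classNorm_mk]

/-- **(A2), strengthened**: `L_w` is ONTO `Q̄_p` (swap ∘ lift ∘ Λ ∘ orbit shift, each onto; `lift` onto at junk classes). [folklore] -/
theorem value_surjective (w : Pt p) : Surjective (value Λ w) := by
  intro ξ
  unfold value
  split_ifs with hw
  · obtain ⟨x', hx'⟩ := ExpModel.lift_surjective p (baseExp p w) ((diagSwap Λ w).symm ξ)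
    obtain ⟨u', hu'⟩ := Λ.surjective x'
    refine ⟨((frobPerm p ^ orbitIdx p w) u').out, ?_⟩
    have hmk : mk p ((frobPerm p ^ orbitIdx p w) u').out = (frobPerm p ^ orbitIdx p w) u' := Quotient.out_eq _
    rw [hmk, rawValue, ← Equiv.Perm.mul_apply, ← zpow_add, neg_add_cancel, zpow_zero, Equiv.Perm.one_apply, hu', hx',
      Equiv.apply_symm_apply]
  · exact ExpModel.lift_surjective p _ ξ

/-- **`Φ`-COMPATIBILITY at classical classes: `L_{σ w}(c^p) = L_w(c)`** — the identity that makes §10.13's transport hold. [folklore] -/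
theorem value_frobPerm {w : Pt p} (hw : 0 < e p w) (c : PadicAlgCl p) : value Λ (frobPerm p w) (c ^ p) = value Λ w c := by
  have hw' : 0 < e p (frobPerm p w) := by
    rw [show (frobPerm p) w = frobPt p w from rfl, Induced.e_frobPt]; exact mul_pos (Nat.cast_pos.2 hp.out.pos) hw
  unfold value
  rw [if_pos hw', if_pos hw, show mk p (c ^ p) = frobPerm p (mk p c) from rfl, rawValue_frobPerm Λ hw, diagSwap, diagSwap, diagValue_frobPerm Λ hw]

/-- **The diagonal value is `p`**: `L_w(c) = p` whenever `[c] = w` is classical (this is `EtaPtTeich`). [folklore] -/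
theorem value_diag {w : Pt p} (hw : 0 < e p w) {c : PadicAlgCl p} (hc : mk p c = w) : value Λ w c = p := by
  unfold value; rw [if_pos hw, hc, diagSwap, show rawValue Λ w w = diagValue Λ w from rfl, Equiv.swap_apply_left]

end Summit.ABC.IUTFork.Joshi.JointModel.Witt

end
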